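import Mathlib
import Summits.HodgeConjecture.HodgeConjecture.Theorems.HodgeLocusLVValuationCases

/-!
# Hodge-locus census (cell `pub-hlocus`, ENGINE A, gen 46) — the ramified cell (R) with the `x = 0` term
admitted: Part H of `HodgeLocusLVValuationCases.lean` with a guarded square-unit hypothesis

certified instances and evidence bearing on the general Hodge conjecture; no claim.

GENERAL, DEFINITION-FREE follow-up sheet (no census data), written on the LEAD's coverage remark N-LVVC-1
(LEAD-READ-LVVC-TWOB-g40): in `law_ramified_of_shape` / `law_ramified_eq_zero_of_odd` the square-unit
hypothesis `hsq : ρ_x F(m′_x) ≠ 0 → ¬ 2·v_ℓ(X_x) < v_ℓ(D)` carries no guard `X_x ≠ 0`; since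
`Nat.factorization 0 = 0`, an index with `X_x = 0` is filed under "case 1" as soon as `ℓ ∣ D`, so `hsq` as
typed demands that the `x = 0` term vanish — true as typed, but narrower than DERIVATION-GK-A.md §5af (R),
whose square-unit argument (`−a·m = x²(1 − D/x²)`, `1 − D/x²` an `ℓ`-adic unit square ⇒ symbol `+1` ⇒ term `0`)
is for `x ≠ 0` only, the `x = 0` term having `v_ℓ(m_0) = v_ℓ(D)` exactly (LEAD's hand row outside the universes:
`(d₁, d₂, ℓ) = (−3, −36, 3)`, `m_0 = 27`, a contributing term with `v = 3 = v_3(108)`).  HERE: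
* `factorization_eq_of_mul_eq` — `ℓ ∤ a`, `a·m = D` ⇒ `v_ℓ(m) = v_ℓ(D)` (the floor at `X_x = 0`);
* `law_ramified_of_shape_guarded`, `law_ramified_eq_zero_of_odd_guarded` — the two Part-H statements with the
  hypothesis GUARDED, `hsq : X_x ≠ 0 → ρ_x F(m′_x) ≠ 0 → ¬ 2·v_ℓ(X_x) < v_ℓ(D)`; indices with `X_x = 0` are
  discharged by `factorization_eq_of_mul_eq`.  Conclusions unchanged: `T_r = Σ_x ρ_x F(m′_x)` for `r ≤ v_ℓ(D)`,
  and `T_r = 0` for `r > v_ℓ(D)` when `v_ℓ(D)` is odd.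
NOT proved here (hypotheses, as before): the Hilbert-symbol mechanism behind `hsq` for `x ≠ 0`, Lemma 2, the
identification of ENGINE A's code objects with these shapes; nothing on the truth side
([cite: LauterViray2015SingularModuli, Thm. 1.5], [cite: GrossZagier1985SingularModuli, Thm. 1.3]).
No `sorry`, no new axioms, no definitions; the accepted files are not edited.
-/

namespace Summit.HodgeConjecture.HodgeConjecture.HodgeLocus.Census.LVRamifiedGuard

open Finset
open Summit.HodgeConjecture.HodgeConjecture.HodgeLocus.Census.LVTermwiseLaw
open Summit.HodgeConjecture.HodgeConjecture.HodgeLocus.Census.LVValuationCases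

set_option linter.dupNamespace false

/-- The `x = 0` term: `ℓ ∤ a`, `a·m = D` ⇒ `v_ℓ(m) = v_ℓ(D)` (any `ℓ`; also when `m = D = 0`). -/
theorem factorization_eq_of_mul_eq {ℓ a m D : ℕ} (ha : ¬ ℓ ∣ a) (hD : a * m = D) :
    m.factorization ℓ = D.factorization ℓ := by
  have ha0 : a ≠ 0 := fun h0 => ha (h0 ▸ dvd_zero ℓ)
  by_cases hm : m = 0
  · subst hm
    rw [mul_zero] at hD
    rw [← hD]
  · rw [← hD, Nat.factorization_mul ha0 hm, Finsupp.add_apply, Nat.factorization_eq_zero_of_not_dvd ha,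
      zero_add]

section Ramified

variable {ι : Type*} {ℓ : ℕ} (s : Finset ι) (F : ℕ → ℤ) (c : ℕ → ℤ) (ρ : ι → ℤ) (m' v : ι → ℕ)

/-- The floor for every index, from the guarded hypothesis: terms `a·(ℓ^{v_x} m′_x) + X_x² = D` with
`ℓ ∤ a m′_x`; if `X_x = 0` then `v_x = v_ℓ(D)`; if `X_x ≠ 0` and the core term is nonzero, `hsq` excludes
case 1 and the trichotomy gives `v_ℓ(D) ≤ v_x`. -/
theorem floor_of_guarded (hℓ : ℓ.Prime) (hm' : ∀ x ∈ s, ¬ ℓ ∣ m' x) {a D : ℕ} (ha : ¬ ℓ ∣ a)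
    (X : ι → ℕ) (hshape : ∀ x ∈ s, a * (ℓ ^ v x * m' x) + X x ^ 2 = D)
    (hsq : ∀ x ∈ s, X x ≠ 0 → ρ x * F (m' x) ≠ 0 → ¬ 2 * (X x).factorization ℓ < D.factorization ℓ) :
    ∀ x ∈ s, ρ x * F (m' x) ≠ 0 → D.factorization ℓ ≤ v x := by
  intro x hx hw
  have hm0 : ℓ ^ v x * m' x ≠ 0 :=
    mul_ne_zero (pow_ne_zero _ hℓ.ne_zero) (fun h0 => hm' x hx (h0 ▸ dvd_zero ℓ))
  by_cases hX : X x = 0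
  · have hD : a * (ℓ ^ v x * m' x) = D := by simpa [hX] using hshape x hx
    have h := factorization_eq_of_mul_eq ha hD
    rw [factorization_prime_pow_mul hℓ (hm' x hx) (v x)] at h
    exact h.symm.le
  · have h := le_factorization_of_not_lt hℓ ha hm0 (hshape x hx) (hsq x hx hX hw)
    rwa [factorization_prime_pow_mul hℓ (hm' x hx) (v x)] at h

/-- (R), floor, GUARDED form of `LVValuationCases.law_ramified_of_shape`: `c ≡ 1`, terms
`a·(ℓ^{v_x} m′_x) + X_x² = D` (`ℓ ∤ a m′_x`), and for `X_x ≠ 0` no nonzero core term in case 1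
(`2v(X_x) < v(D)`; the Hilbert-symbol input) ⇒ `T_r = Σ_x ρ_x F(m′_x)` for every `r ≤ v_ℓ(D)`.
The `x = 0` term (`X_x = 0`, `v_x = v_ℓ(D)`) is now admitted whether or not it vanishes. -/
theorem law_ramified_of_shape_guarded (hℓ : ℓ.Prime) (hF : ∀ e n, ¬ ℓ ∣ n → F (ℓ ^ e * n) = c e * F n)
    (hc : ∀ e, c e = 1) (hm' : ∀ x ∈ s, ¬ ℓ ∣ m' x) {a D : ℕ} (ha : ¬ ℓ ∣ a) (X : ι → ℕ)
    (hshape : ∀ x ∈ s, a * (ℓ ^ v x * m' x) + X x ^ 2 = D)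
    (hsq : ∀ x ∈ s, X x ≠ 0 → ρ x * F (m' x) ≠ 0 → ¬ 2 * (X x).factorization ℓ < D.factorization ℓ)
    {r : ℕ} (hr : r ≤ D.factorization ℓ) :
    ∑ x ∈ s, (if ℓ ^ r ∣ ℓ ^ v x * m' x then ρ x * F (ℓ ^ v x * m' x / ℓ ^ r) else 0)
      = ∑ x ∈ s, ρ x * F (m' x) :=
  law_ramified s F c ρ m' v hℓ hF hc hm' (D.factorization ℓ)
    (floor_of_guarded s F ρ m' v hℓ hm' ha X hshape hsq) hr

/-- (R), ceiling, GUARDED form of `LVValuationCases.law_ramified_eq_zero_of_odd`: same shape and guarded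
`hsq`, `v_ℓ(D)` odd ⇒ `T_r = 0` for every `r > v_ℓ(D)` (for `X_x = 0`, `v_x = v_ℓ(D)` exactly; for
`X_x ≠ 0` the equal case `2v(X_x) = v(D)` is impossible by parity). -/
theorem law_ramified_eq_zero_of_odd_guarded (hℓ : ℓ.Prime)
    (hF : ∀ e n, ¬ ℓ ∣ n → F (ℓ ^ e * n) = c e * F n)
    (hm' : ∀ x ∈ s, ¬ ℓ ∣ m' x) {a D : ℕ} (ha : ¬ ℓ ∣ a) (X : ι → ℕ)
    (hshape : ∀ x ∈ s, a * (ℓ ^ v x * m' x) + X x ^ 2 = D)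
    (hsq : ∀ x ∈ s, X x ≠ 0 → ρ x * F (m' x) ≠ 0 → ¬ 2 * (X x).factorization ℓ < D.factorization ℓ)
    (hE : Odd (D.factorization ℓ)) {r : ℕ} (hr : D.factorization ℓ < r) :
    ∑ x ∈ s, (if ℓ ^ r ∣ ℓ ^ v x * m' x then ρ x * F (ℓ ^ v x * m' x / ℓ ^ r) else 0) = 0 := by
  refine law_eq_zero_of_gt s F c ρ m' v hℓ hF hm' (D.factorization ℓ) ?_ hr
  intro x hx hw
  have hm0 : ℓ ^ v x * m' x ≠ 0 :=
    mul_ne_zero (pow_ne_zero _ hℓ.ne_zero) (fun h0 => hm' x hx (h0 ▸ dvd_zero ℓ))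
  by_cases hX : X x = 0
  · have hD : a * (ℓ ^ v x * m' x) = D := by simpa [hX] using hshape x hx
    have h := factorization_eq_of_mul_eq ha hD
    rw [factorization_prime_pow_mul hℓ (hm' x hx) (v x)] at h
    exact h.le
  · have h := factorization_eq_of_not_lt_of_odd hℓ ha hm0 (hshape x hx) (hsq x hx hX hw) hE
    rw [factorization_prime_pow_mul hℓ (hm' x hx) (v x)] at h
    exact h.le

/-- The unguarded Part-H hypothesis implies the guarded one (so the guarded theorems are at least as
strong as the accepted ones). -/
theorem guarded_of_unguarded {D : ℕ} (X : ι → ℕ)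
    (hsq : ∀ x ∈ s, ρ x * F (m' x) ≠ 0 → ¬ 2 * (X x).factorization ℓ < D.factorization ℓ) :
    ∀ x ∈ s, X x ≠ 0 → ρ x * F (m' x) ≠ 0 → ¬ 2 * (X x).factorization ℓ < D.factorization ℓ :=
  fun x hx _ hw => hsq x hx hw

end Ramified

end Summit.HodgeConjecture.HodgeConjecture.HodgeLocus.Census.LVRamifiedGuard
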